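import Summits.QuantumFields.YangMills.Theorems.ColdStartUniversalityShenZhuZhuGradientFormSUN
import Summits.Ventures.YMGap.RobustBall.HaarSecondMoments
import Literature.Barriers.QuantumFields.ElitzurTheorem
import Literature.MathematicalPhysics.QuantumFieldTheory.ConstructiveQFTWave0Proofs
import HarnessLib

/-!
# THE HAAR CEILING (Elitzur): at EVERY coupling and EVERY volume the spectral gap of the `SU(N)` lattice Langevin generator is at most the
# free one-link value `(N² − 1)/N` — single-link marginals of the Wilson measure are Haar, so link-ENTRY observables have Dirichlet-to-variance
# ratio EXACTLY `N − 1/N`, whatever `β`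

Seat `ym-line-csu-p1` (g40), route `ColdStartUniversality` of `Summits/QuantumFields/YangMills`, helper file G33 (`--supports stmt-QuantumFields-24809`).
g19 proved the `SU(2)`, `d = 3` instance in the seat's generator currency (`…LatticeLangevinWilsonGapUpperBound`: `λ ≤ 3/2`; `…WilsonLinkMarginal`:
`integral_link_eq_haar` for `SU(2)`, `d = 3`, continuous test functions); THIS file does every `SU(N)`, every `d`, in the venture `YMGap`'s
Γ-currency (the currency of G21/G31/G32), with the exact constant `N − 1/N`, and the marginal lemma for every compact second-countable `G`.
The fixed-cut-off package bounds the Poincaré constant of the SZZ dynamics from BELOW (`K = N/2 − 4dN|β|` at strong coupling, G21/G31; Holley–Stroock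
`e^{−O(β'L^d)}` at every coupling, g19).  This file bounds it from ABOVE, uniformly in the coupling and the volume, by a two-line mechanism: gauge
invariance of the Wilson measure makes the law of any single link HAAR (Elitzur 1975; the tree's `wilsonMeasure_map_gaugeTransform_holds`), and for the
`2N²` link-entry observables `Re Q_{ab}, Im Q_{ab}` of one link the one-link carré du champ integrates, under Haar, to exactly `(N − 1/N)·∫f²`
(Casimir `Σ_α Y_α² = −(N − 1/N)·1`, integration by parts on `SU(N)`), while `Σ_{ab} ∫ |Q_{ab}|² = N`.  Hence:

* §1 one link, Haar: `Lap_reTrMul_sun` (`Δ Re tr(·M) = −(N − 1/N) Re tr(·M)`), `integral_Gam_reTrMul_sun`, `integral_reTrMul_eq_zero_sun` (centre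
  `e^{2πi/N}·1`, `N ≥ 2`), `sum_integral_sq_entries_sun` (`= N`).
* §2 ★★ `integral_link_eq_haar_general` — SINGLE-LINK MARGINALS OF THE WILSON MEASURE ARE HAAR: `∫ g(U_{e₀}) dμ_{Λ_L,β} = ∫ g dσ_G` for every compact second-countable
  `G`, continuous `ρ`, every `β`, `d`, `L ≥ 2`, link `e₀`, bounded measurable `g` (gauge rotation at the source of `e₀`, Fubini, invariance of Haar).
* §3 `Gam_comp_eval_sun` — the lattice carré du champ of a one-link function is the one-link carré du champ.
* §4 ★★★ `rayleigh_linkEntries_sun` — for EVERY `β'`, `L ≥ 2`, `d`, link `e₀`: `Σ_{f} ∫ Γ(f) dμ_{Λ_L,β'} = (N − 1/N)·Σ_f Var_{μ_{Λ_L,β'}}(f)` and `Σ_f Var = N`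
  over the `2N²` entry observables of `U_{e₀}`; ★★★ `poincareConst_le_haarCeiling_sun` — THE CEILING: if `c·Var_{μ_{Λ_L,β'}}(u) ≤ ∫ Γ(u,u) dμ_{Λ_L,β'}` for all
  smooth `u` of the link matrices, then `c ≤ N − 1/N`; with G21: `N/2 − 4dN|β| ≤ c_opt ≤ N − 1/N` for `|β| < 1/(8d)` (`poincareConst_window_sun`).

THEOREMS ONLY, no definition, no sorry.  HONEST FRAMING: a structural fixed-lattice fact (no drift can make the SZZ dynamics relax faster than free
diffusion of one link); it says NOTHING about `K`-uniformity in physical units along the route's scaling (`UniformColdStartMixing`, 24809, ASIDE, not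
restated), nothing at weak coupling beyond the ceiling itself, nothing in the continuum; no crux, rung or summit statement is proved; the Yang–Mills
mass gap is NOT proved.  References: S. Elitzur, Phys. Rev. D 12 (1975) 3978 [Elitzur1975]; H. Shen, R. Zhu, X. Zhu, CMP 400 (2023) 805–851, §2,
Remark 4.6 [ShenZhuZhu2022]; M. Creutz, *Quarks, gluons and lattices* (1983) (8.20).
-/

set_option autoImplicit false

noncomputable section

namespace Summit.QuantumFields.YangMills.Theorems.ColdStartUniversality

open MeasureTheory ProbabilityTheory Finset Filter Set Function
open scoped BigOperators NNReal ENNReal Topology Matrix Matrix.Norms.Frobenius ContDiff ComplexConjugate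
open Literature.MathematicalPhysics.QuantumFieldTheory
open Literature.MathematicalPhysics.QuantumLattice (fundamentalRep continuous_fundamentalRep fundamentalRep_apply)
open Literature.MathematicalPhysics.QuantumFieldTheory.SUNBakryEmery (SUN FrameIdx frame matD matD_apply matD_reTrMul contDiff_reTrMul
  sum_frame_mul_frame integral_mul_Lap haarSU)
open Summit.Ventures.YMGap.LatticeBakryEmery (PSU Cfg emb emb_apply Gam lk algD algD_apply linkFun linkFun_apply Gam_self_eq_sum_linkFun)

variable {N : ℕ}

/-! ## §1. One link under Haar: the entry observables `Re tr(Q M)` -/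

section OneLink

/-- **The link-entry observables are eigenfunctions of the Laplacian of `SU(N)`**: `Δ Re tr(·M) = −(N − 1/N)·Re tr(·M)` for every `M ∈ M_N(ℂ)` (`N ≥ 1`;
Casimir `Σ_α Y_α² = −(N − 1/N)·1` of the Parseval frame, SZZ's Hilbert–Schmidt normalisation). [cite: ShenZhuZhu2022, §2 (2.3)–(2.4)] -/
theorem Lap_reTrMul_sun (hN : N ≠ 0) (M : Matrix (Fin N) (Fin N) ℂ) :
    SUNBakryEmery.Lap (fun Q : Matrix (Fin N) (Fin N) ℂ => (Q * M).trace.re) =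
      fun Q => -(((N : ℝ) - 1 / N) * (Q * M).trace.re) := by
  funext Q
  unfold SUNBakryEmery.Lap
  have h1 : ∀ α : FrameIdx N, matD (frame α) (matD (frame α) fun Q : Matrix (Fin N) (Fin N) ℂ => (Q * M).trace.re) Q =
      (Q * (frame α * frame α) * M).trace.re := by
    intro α
    rw [matD_reTrMul, show (fun Q : Matrix (Fin N) (Fin N) ℂ => (Q * frame α * M).trace.re) =
        fun Q => (Q * (frame α * M)).trace.re from funext fun Q => by rw [Matrix.mul_assoc], matD_reTrMul]
    simp only [Matrix.mul_assoc]
  simp_rw [h1]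
  rw [← Complex.re_sum, ← Matrix.trace_sum, ← Finset.sum_mul, ← Finset.mul_sum, sum_frame_mul_frame hN, Matrix.mul_neg, Matrix.mul_smul,
    Matrix.mul_one, Matrix.neg_mul, Matrix.smul_mul, Matrix.trace_neg, Matrix.trace_smul, smul_eq_mul]
  have hz : ((N : ℂ) - 1 / N) = (((N : ℝ) - 1 / N : ℝ) : ℂ) := by push_cast; ring
  rw [hz, Complex.neg_re, Complex.re_ofReal_mul]

/-- **Integration by parts on `SU(N)`**: `∫ Γ(f_M,f_M) dσ = (N − 1/N) ∫ f_M² dσ` for `f_M = Re tr(·M)`. [cite: ShenZhuZhu2022, §2 (2.3)–(2.4)] -/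
theorem integral_Gam_reTrMul_sun (hN : N ≠ 0) (M : Matrix (Fin N) (Fin N) ℂ) :
    ∫ g : SUN N, SUNBakryEmery.Gam (fun Q : Matrix (Fin N) (Fin N) ℂ => (Q * M).trace.re) (fun Q => (Q * M).trace.re) g ∂(haarSU N) =
      ((N : ℝ) - 1 / N) * ∫ g : SUN N, ((g : Matrix (Fin N) (Fin N) ℂ) * M).trace.re ^ 2 ∂(haarSU N) := by
  have h := integral_mul_Lap hN (contDiff_reTrMul M) (contDiff_reTrMul M)
  rw [Lap_reTrMul_sun hN M] at h
  have h2 : ∫ g : SUN N, ((g : Matrix (Fin N) (Fin N) ℂ) * M).trace.re * -(((N : ℝ) - 1 / N) * ((g : Matrix (Fin N) (Fin N) ℂ) * M).trace.re) ∂(haarSU N) =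
      -(((N : ℝ) - 1 / N) * ∫ g : SUN N, ((g : Matrix (Fin N) (Fin N) ℂ) * M).trace.re ^ 2 ∂(haarSU N)) := by
    rw [← integral_const_mul, ← integral_neg]
    refine integral_congr_ae (ae_of_all _ fun g => ?_)
    ring
  linarith [h, h2]

/-- **Link entries have Haar mean zero** (`N ≥ 2`): `∫ (Q M)-trace dσ = 0`, by invariance of Haar under the centre element `e^{2πi/N}·1 ≠ 1`.
[cite: Elitzur1975, (centre average)] -/
theorem integral_trace_mul_eq_zero_sun (hN : 2 ≤ N) (M : Matrix (Fin N) (Fin N) ℂ) :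
    ∫ g : SUN N, ((g : Matrix (Fin N) (Fin N) ℂ) * M).trace ∂(haarSU N) = 0 := by
  have hN0 : N ≠ 0 := by omega
  set ζ : ℂ := Complex.exp (2 * Real.pi * Complex.I / N) with hζ
  have hprim : IsPrimitiveRoot ζ N := Complex.isPrimitiveRoot_exp N hN0
  have hζ1 : ζ ≠ 1 := hprim.ne_one hN
  set z : SUN N := ⟨ζ • (1 : Matrix (Fin N) (Fin N) ℂ), Summit.Ventures.YMGap.RobustBall.HaarSecondMoments.smul_one_mem hN0⟩ with hz
  have hinv := integral_mul_left_eq_self (μ := haarSU N) (fun g : SUN N => ((g : Matrix (Fin N) (Fin N) ℂ) * M).trace) z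
  have hmul : ∀ g : SUN N, (((z * g : SUN N) : Matrix (Fin N) (Fin N) ℂ) * M).trace = ζ * (((g : Matrix (Fin N) (Fin N) ℂ)) * M).trace := by
    intro g
    show ((ζ • (1 : Matrix (Fin N) (Fin N) ℂ)) * (g : Matrix (Fin N) (Fin N) ℂ) * M).trace = _
    rw [Matrix.smul_mul, Matrix.one_mul, Matrix.smul_mul, Matrix.trace_smul, smul_eq_mul]
  simp_rw [hmul] at hinv
  rw [integral_const_mul] at hinv
  have : (ζ - 1) * ∫ g : SUN N, ((g : Matrix (Fin N) (Fin N) ℂ) * M).trace ∂(haarSU N) = 0 := by rw [sub_mul, one_mul, hinv, sub_self]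
  exact (mul_eq_zero.1 this).resolve_left (sub_ne_zero.2 hζ1)

/-- `∫ Re tr(Q M) dσ = 0` (`N ≥ 2`). [cite: Elitzur1975, (centre average)] -/
theorem integral_reTrMul_eq_zero_sun (hN : 2 ≤ N) (M : Matrix (Fin N) (Fin N) ℂ) :
    ∫ g : SUN N, ((g : Matrix (Fin N) (Fin N) ℂ) * M).trace.re ∂(haarSU N) = 0 := by
  have hc : Continuous fun g : SUN N => ((g : Matrix (Fin N) (Fin N) ℂ) * M).trace :=
    (continuous_subtype_val.mul continuous_const).matrix_trace
  have hint : Integrable (fun g : SUN N => ((g : Matrix (Fin N) (Fin N) ℂ) * M).trace) (haarSU N) :=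
    hc.integrable_of_hasCompactSupport (HasCompactSupport.of_compactSpace _)
  have h := integral_trace_mul_eq_zero_sun hN M
  have h2 := integral_re hint
  simp only [RCLike.re_to_complex, h, Complex.zero_re] at h2
  exact h2

/-- The trace against a matrix unit reads off an entry: `tr(Q · E_{ba}(c)) = c · Q_{ab}`. [folklore] -/
theorem trace_mul_single (Q : Matrix (Fin N) (Fin N) ℂ) (a b : Fin N) (c : ℂ) : (Q * Matrix.single b a c).trace = c * Q a b := by
  rw [Matrix.trace]
  simp only [Matrix.diag_apply]
  rw [Finset.sum_eq_single a (fun j _ hj => Matrix.mul_single_apply_of_ne (c := c) (i := b) (j := a) (a := j) (b := j) hj Q)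
    (fun h => absurd (Finset.mem_univ a) h), Matrix.mul_single_apply_same, mul_comm]

/-- **`Σ_{a,b} ∫ (Re Q_{ab})² + (Im Q_{ab})² dσ = N`** (Schur orthogonality `∫ |Q_{ab}|² = 1/N`, `N ≥ 1`). [cite: ShenZhuZhu2022, §2 (2.3)–(2.4)] -/
theorem sum_integral_sq_entries_sun (hN : N ≠ 0) :
    ∑ a : Fin N, ∑ b : Fin N,
      (∫ g : SUN N, ((g : Matrix (Fin N) (Fin N) ℂ) * Matrix.single b a (1 : ℂ)).trace.re ^ 2 ∂(haarSU N) +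
        ∫ g : SUN N, ((g : Matrix (Fin N) (Fin N) ℂ) * Matrix.single b a (-Complex.I)).trace.re ^ 2 ∂(haarSU N)) = N := by
  have hent : ∀ a b : Fin N,
      (∫ g : SUN N, ((g : Matrix (Fin N) (Fin N) ℂ) * Matrix.single b a (1 : ℂ)).trace.re ^ 2 ∂(haarSU N) +
        ∫ g : SUN N, ((g : Matrix (Fin N) (Fin N) ℂ) * Matrix.single b a (-Complex.I)).trace.re ^ 2 ∂(haarSU N)) = 1 / N := by
    intro a b
    have hc1 : Continuous fun g : SUN N => ((g : Matrix (Fin N) (Fin N) ℂ) a b) := continuous_subtype_val.matrix_elem a b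
    have hre : Continuous fun g : SUN N => ((g : Matrix (Fin N) (Fin N) ℂ) a b).re ^ 2 := (Complex.continuous_re.comp hc1).pow 2
    have him : Continuous fun g : SUN N => ((g : Matrix (Fin N) (Fin N) ℂ) a b).im ^ 2 := (Complex.continuous_im.comp hc1).pow 2
    simp_rw [trace_mul_single, one_mul, show ∀ z : ℂ, (-Complex.I * z).re = z.im from fun z => by simp]
    rw [← integral_add (hre.integrable_of_hasCompactSupport (HasCompactSupport.of_compactSpace _))
      (him.integrable_of_hasCompactSupport (HasCompactSupport.of_compactSpace _))]
    have hmom := Summit.Ventures.YMGap.RobustBall.HaarSecondMoments.integral_entry_mul_conj_entry_suN (N := N) a b a b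
    simp only [and_self, if_true] at hmom
    have hre' : ∀ g : SUN N, ((g : Matrix (Fin N) (Fin N) ℂ) a b).re ^ 2 + ((g : Matrix (Fin N) (Fin N) ℂ) a b).im ^ 2 =
        (((g : Matrix (Fin N) (Fin N) ℂ) a b) * (starRingEnd ℂ) ((g : Matrix (Fin N) (Fin N) ℂ) a b)).re := by
      intro g; rw [Complex.mul_conj, Complex.ofReal_re, Complex.normSq_apply]; ring
    simp_rw [hre']
    have hint : Integrable (fun g : SUN N => ((g : Matrix (Fin N) (Fin N) ℂ) a b) * (starRingEnd ℂ) ((g : Matrix (Fin N) (Fin N) ℂ) a b)) (haarSU N) :=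
      (hc1.mul (Complex.continuous_conj.comp hc1)).integrable_of_hasCompactSupport (HasCompactSupport.of_compactSpace _)
    have h3 := integral_re hint
    simp only [RCLike.re_to_complex] at h3
    rw [h3]
    show (∫ g : SUN N, ((g : Matrix (Fin N) (Fin N) ℂ) a b) * (starRingEnd ℂ) ((g : Matrix (Fin N) (Fin N) ℂ) a b) ∂(haarProbability (SUN N))).re = 1 / N
    rw [hmom]
    simp
  simp_rw [hent]
  simp only [Finset.sum_const, Finset.card_univ, Fintype.card_fin, nsmul_eq_mul]
  have hNr : (N : ℝ) ≠ 0 := Nat.cast_ne_zero.2 hN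
  field_simp

end OneLink

/-! ## §2. Single-link marginals of the Wilson measure are Haar (Elitzur) -/

section Marginal

variable {G : Type*} [Group G] [TopologicalSpace G] [IsTopologicalGroup G] [CompactSpace G] [SecondCountableTopology G]
  [MeasurableSpace G] [BorelSpace G] {d L : ℕ} [NeZero L]

omit [NeZero L] in
/-- On a torus of side `L ≥ 2` the endpoint `x + e_i` of a link differs from its source `x` (the statement of the unbuilt venture leaf
`RobustBall.EnergyVariance.shift_ne_self`, re-proved here; g19's `shift_ne_self` is the `d = 3` case). [folklore] -/
theorem site_shift_ne_self_of_one_lt (hL : 1 < L) (x : Site d L) (i : Fin d) : x.shift i ≠ x := by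
  intro h
  have h1 := congrFun h i
  simp only [Site.shift, Pi.add_apply, Pi.single_eq_same, add_eq_left] at h1
  haveI : Fact (1 < L) := ⟨hL⟩
  exact one_ne_zero h1

/-- ★★ **Single-link marginals of the Wilson measure are Haar** (Elitzur 1975; Creutz Ch. 9): for every compact second-countable gauge group `G`,
continuous representation `ρ`, coupling `β`, torus `(ℤ/L)^d` with `L ≥ 2`, link `e₀` and bounded measurable `g : G → ℝ`,
`∫ g(U_{e₀}) dμ_{Λ_L,β}(U) = ∫ g dσ_G` — the gauge rotation by `k` at the source of `e₀` maps `U_{e₀} ↦ k U_{e₀}` and preserves `μ_{Λ_L,β}`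
(`wilsonMeasure_map_gaugeTransform_holds`); average over `k ∈ G` (Fubini) and use the invariance of Haar measure. [cite: Elitzur1975, (local gauge invariance)] -/
theorem integral_link_eq_haar_general {N' : ℕ} (ρ : G →* Matrix (Fin N') (Fin N') ℂ) (hρ : Continuous ρ) (β : ℝ) (hL : 1 < L) (e₀ : Edge d L)
    (g : G → ℝ) (hg : Measurable g) {B : ℝ} (hB : ∀ x, |g x| ≤ B) :
    ∫ U, g (U e₀) ∂(wilsonMeasure (d := d) (L := L) ρ β) = ∫ x, g x ∂(haarProbability G) := by
  set μ := wilsonMeasure (d := d) (L := L) ρ β with hμ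
  haveI : IsProbabilityMeasure μ := isProbabilityMeasure_wilsonMeasure (d := d) (L := L) ρ hρ β
  -- the gauge rotation by `k` at the source of `e₀`
  set γ : G → Site d L → G := fun k => Function.update (fun _ => (1 : G)) e₀.1 k with hγ
  have hγe : ∀ (k : G) (U : GaugeConfig d L G), gaugeTransform (γ k) U e₀ = k * U e₀ := by
    intro k U
    simp only [gaugeTransform, hγ, Function.update_self, Function.update_of_ne (site_shift_ne_self_of_one_lt hL e₀.1 e₀.2), inv_one, mul_one]
  -- step 1: invariance under each rotation
  have h1 : ∀ k : G, ∫ U, g (k * U e₀) ∂μ = ∫ U, g (U e₀) ∂μ := by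
    intro k
    have hmp : MeasurePreserving (Literature.Barriers.QuantumFields.Elitzur.gaugeTransformMEquiv (d := d) (L := L) (G := G) (γ k)) μ μ :=
      ⟨(Literature.Barriers.QuantumFields.Elitzur.measurePreserving_gaugeTransform (γ k)).measurable,
        wilsonMeasure_map_gaugeTransform_holds (d := d) (L := L) ρ β (γ k)⟩
    have h := hmp.integral_comp' (fun U : GaugeConfig d L G => g (U e₀))
    simp only [Literature.Barriers.QuantumFields.Elitzur.gaugeTransformMEquiv, MeasurableEquiv.coe_mk, Equiv.coe_fn_mk, hγe] at h
    exact h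
  -- step 2: average over `k` (Fubini) and use the invariance of Haar measure
  have hmeas : Measurable fun p : G × GaugeConfig d L G => g (p.1 * p.2 e₀) :=
    hg.comp (measurable_fst.mul ((measurable_pi_apply e₀).comp measurable_snd))
  have hint : Integrable (fun p : G × GaugeConfig d L G => g (p.1 * p.2 e₀)) ((haarProbability G).prod μ) :=
    (integrable_const B).mono' hmeas.aestronglyMeasurable (ae_of_all _ fun p => by rw [Real.norm_eq_abs]; exact hB _)
  calc ∫ U, g (U e₀) ∂μ = ∫ k, ∫ U, g (k * U e₀) ∂μ ∂(haarProbability G) := by simp_rw [h1]; simp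
    _ = ∫ U, ∫ k, g (k * U e₀) ∂(haarProbability G) ∂μ := integral_integral_swap hint
    _ = ∫ U, ∫ k, g k ∂(haarProbability G) ∂μ := by
        refine integral_congr_ae (ae_of_all _ fun U => ?_)
        exact integral_mul_right_eq_self (μ := haarProbability G) g (U e₀)
    _ = ∫ x, g x ∂(haarProbability G) := by simp

end Marginal

/-! ## §3. The lattice carré du champ of a one-link function -/

section Lattice

universe u

variable {ι : Type u} [Fintype ι] [DecidableEq ι]

/-- **The lattice carré du champ of a function of one link is the one-link carré du champ**: for `u(Q) = f(Q_{e₀})`,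
`Γ(u,u)(Q) = Γ₁(f,f)(Q_{e₀})` (`Γ` the venture's `LatticeBakryEmery.Gam`, `Γ₁` the Literature's `SUNBakryEmery.Gam`). [cite: ShenZhuZhu2022, §2 (2.3)–(2.4)] -/
theorem Gam_comp_eval_sun (e₀ : ι) {f : Matrix (Fin N) (Fin N) ℂ → ℝ} (hf : ContDiff ℝ ∞ f) (Q : Cfg ι N) :
    Gam (fun Q : Cfg ι N => f (Q e₀)) (fun Q : Cfg ι N => f (Q e₀)) Q = SUNBakryEmery.Gam f f (Q e₀) := by
  classical
  set P : Cfg ι N →L[ℝ] Matrix (Fin N) (Fin N) ℂ := ContinuousLinearMap.proj (R := ℝ) (φ := fun _ : ι => Matrix (Fin N) (Fin N) ℂ) e₀ with hP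
  have hu : (fun Q : Cfg ι N => f (Q e₀)) = f ∘ P := rfl
  have hfd : Differentiable ℝ f := hf.differentiable (by simp)
  have hFD : HasFDerivAt (fun Q : Cfg ι N => f (Q e₀)) ((fderiv ℝ f (Q e₀)).comp P) Q := by
    rw [hu]; exact (hfd (P Q)).hasFDerivAt.comp Q P.hasFDerivAt
  have halgD : ∀ (e : ι) (Y : Matrix (Fin N) (Fin N) ℂ), algD (lk e Y) (fun Q : Cfg ι N => f (Q e₀)) Q =
      if e = e₀ then matD Y f (Q e₀) else 0 := by
    intro e Y
    rw [algD_apply]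
    have h := congrFun (congrArg DFunLike.coe hFD.fderiv) (Q * lk e Y)
    refine h.trans ?_
    show fderiv ℝ f (Q e₀) ((Q * lk e Y) e₀) = _
    by_cases he : e = e₀
    · subst he
      have : (Q * lk e Y) e = Q e * Y := by simp [lk]
      rw [if_pos rfl, this]
      rfl
    · rw [if_neg he]
      have : (Q * lk e Y) e₀ = 0 := by simp [lk, Pi.single_eq_of_ne (Ne.symm he)]
      rw [this, map_zero]
  rw [Gam_self_eq_sum_linkFun]
  simp only [linkFun_apply, halgD]
  rw [Finset.sum_eq_single e₀ (fun e _ he => by simp [he]) (fun h => absurd (Finset.mem_univ e₀) h)]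
  simp only [if_true, SUNBakryEmery.Gam, sq]

end Lattice

/-! ## §4. The Haar ceiling on every torus, every coupling -/

section Ceiling

variable {d L : ℕ} [NeZero L]

/-- ★★★ **Exact Rayleigh quotients at every coupling (Elitzur)**: for `N ≥ 2`, every `β'`, every torus `(ℤ/L)^d` with `L ≥ 2` and every link `e₀`, the
`2N²` link-entry observables `f(U) = Re tr(U_{e₀} M)`, `M ∈ {E_{ba}, −i E_{ba}}` (i.e. `Re U_{e₀,ab}`, `Im U_{e₀,ab}`) satisfy
`Σ_f ∫ Γ(f,f) dμ_{Λ_L,β'} = (N − 1/N) · N` and `Σ_f Var_{μ_{Λ_L,β'}}(f) = N` — their law is Haar whatever the coupling.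
[cite: Elitzur1975, (local gauge invariance)] -/
theorem rayleigh_linkEntries_sun (hN : 2 ≤ N) (hL : 1 < L) (β' : ℝ) (e₀ : Edge d L) :
    (∑ a : Fin N, ∑ b : Fin N, ∑ c ∈ ({(1 : ℂ), -Complex.I} : Finset ℂ),
        ∫ U, Gam (fun Q : Cfg (Edge d L) N => (Q e₀ * Matrix.single b a c).trace.re) (fun Q => (Q e₀ * Matrix.single b a c).trace.re) (emb U)
          ∂(wilsonMeasure (d := d) (L := L) (fundamentalRep (Fin N)) β') = ((N : ℝ) - 1 / N) * N) ∧
    (∑ a : Fin N, ∑ b : Fin N, ∑ c ∈ ({(1 : ℂ), -Complex.I} : Finset ℂ),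
        Var[fun U : GaugeConfig d L (SUN N) => ((U e₀ : Matrix (Fin N) (Fin N) ℂ) * Matrix.single b a c).trace.re;
          wilsonMeasure (d := d) (L := L) (fundamentalRep (Fin N)) β'] = N) := by
  have hN0 : N ≠ 0 := by omega
  set μ := wilsonMeasure (d := d) (L := L) (fundamentalRep (Fin N)) β' with hμ
  haveI : IsProbabilityMeasure μ := isProbabilityMeasure_wilsonMeasure (d := d) (L := L) (fundamentalRep (Fin N)) (continuous_fundamentalRep (n := Fin N)) β'
  haveI : SecondCountableTopology (Matrix (Fin N) (Fin N) ℂ) := inferInstanceAs (SecondCountableTopology (Fin N → Fin N → ℂ))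
  haveI : SecondCountableTopology (SUN N) := Topology.IsEmbedding.subtypeVal.secondCountableTopology
  have hne : (1 : ℂ) ∉ ({-Complex.I} : Finset ℂ) := by
    rw [Finset.mem_singleton]; intro h; have := congrArg Complex.re h; simp at this
  -- per observable: marginal transfer
  have key : ∀ M : Matrix (Fin N) (Fin N) ℂ,
      (∫ U, Gam (fun Q : Cfg (Edge d L) N => (Q e₀ * M).trace.re) (fun Q => (Q e₀ * M).trace.re) (emb U) ∂μ =
          ((N : ℝ) - 1 / N) * ∫ g : SUN N, ((g : Matrix (Fin N) (Fin N) ℂ) * M).trace.re ^ 2 ∂(haarSU N)) ∧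
      Var[fun U : GaugeConfig d L (SUN N) => ((U e₀ : Matrix (Fin N) (Fin N) ℂ) * M).trace.re; μ] =
          ∫ g : SUN N, ((g : Matrix (Fin N) (Fin N) ℂ) * M).trace.re ^ 2 ∂(haarSU N) := by
    intro M
    set fM : Matrix (Fin N) (Fin N) ℂ → ℝ := fun Q => (Q * M).trace.re with hfM
    have hfc : ContDiff ℝ ∞ fM := contDiff_reTrMul M
    have hgc : Continuous fun g : SUN N => fM g := hfc.continuous.comp continuous_subtype_val
    obtain ⟨B, hB⟩ : ∃ B, ∀ g : SUN N, |fM g| ≤ B := by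
      obtain ⟨B, hB⟩ := (isCompact_univ (X := SUN N)).exists_bound_of_continuousOn hgc.continuousOn
      exact ⟨B, fun g => by simpa [Real.norm_eq_abs] using hB g (Set.mem_univ _)⟩
    have hGc : Continuous fun g : SUN N => SUNBakryEmery.Gam fM fM g :=
      (SUNBakryEmery.contDiff_Gam hfc hfc).continuous.comp continuous_subtype_val
    obtain ⟨B', hB'⟩ : ∃ B', ∀ g : SUN N, |SUNBakryEmery.Gam fM fM g| ≤ B' := by
      obtain ⟨B', hB'⟩ := (isCompact_univ (X := SUN N)).exists_bound_of_continuousOn hGc.continuousOn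
      exact ⟨B', fun g => by simpa [Real.norm_eq_abs] using hB' g (Set.mem_univ _)⟩
    refine ⟨?_, ?_⟩
    · calc ∫ U, Gam (fun Q : Cfg (Edge d L) N => (Q e₀ * M).trace.re) (fun Q => (Q e₀ * M).trace.re) (emb U) ∂μ
          = ∫ U, SUNBakryEmery.Gam fM fM ((U e₀ : SUN N) : Matrix (Fin N) (Fin N) ℂ) ∂μ :=
            integral_congr_ae (ae_of_all _ fun U => Gam_comp_eval_sun e₀ hfc (emb U))
        _ = ∫ g : SUN N, SUNBakryEmery.Gam fM fM g ∂(haarProbability (SUN N)) :=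
            integral_link_eq_haar_general (fundamentalRep (Fin N)) (continuous_fundamentalRep (n := Fin N)) β' hL e₀
              (fun g : SUN N => SUNBakryEmery.Gam fM fM g) hGc.measurable hB'
        _ = ((N : ℝ) - 1 / N) * ∫ g : SUN N, ((g : Matrix (Fin N) (Fin N) ℂ) * M).trace.re ^ 2 ∂(haarSU N) :=
            integral_Gam_reTrMul_sun hN0 M
    · have hmem : MemLp (fun U : GaugeConfig d L (SUN N) => fM ((U e₀ : SUN N) : Matrix (Fin N) (Fin N) ℂ)) 2 μ :=
        MemLp.of_bound ((hgc.comp (continuous_apply e₀)).aestronglyMeasurable) B (ae_of_all _ fun U => by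
          rw [Real.norm_eq_abs]; exact hB _)
      have h1 := integral_link_eq_haar_general (fundamentalRep (Fin N)) (continuous_fundamentalRep (n := Fin N)) β' hL e₀
        (fun g : SUN N => fM g) hgc.measurable hB
      have h2 := integral_link_eq_haar_general (fundamentalRep (Fin N)) (continuous_fundamentalRep (n := Fin N)) β' hL e₀
        (fun g : SUN N => fM g ^ 2) (hgc.pow 2).measurable (B := B ^ 2) (fun g => by rw [abs_pow]; exact pow_le_pow_left₀ (abs_nonneg _) (hB g) 2)
      rw [integral_reTrMul_eq_zero_sun hN M] at h1
      rw [variance_eq_sub hmem]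
      show (∫ U, fM ((U e₀ : SUN N) : Matrix (Fin N) (Fin N) ℂ) ^ 2 ∂μ) - (∫ U, fM ((U e₀ : SUN N) : Matrix (Fin N) (Fin N) ℂ) ∂μ) ^ 2 = _
      rw [h2, h1, zero_pow two_ne_zero, sub_zero]
  have k1 : ∀ M : Matrix (Fin N) (Fin N) ℂ,
      ∫ U, Gam (fun Q : Cfg (Edge d L) N => (Q e₀ * M).trace.re) (fun Q => (Q e₀ * M).trace.re) (emb U) ∂μ =
        ((N : ℝ) - 1 / N) * ∫ g : SUN N, ((g : Matrix (Fin N) (Fin N) ℂ) * M).trace.re ^ 2 ∂(haarSU N) := fun M => (key M).1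
  have k2 : ∀ M : Matrix (Fin N) (Fin N) ℂ,
      Var[fun U : GaugeConfig d L (SUN N) => ((U e₀ : Matrix (Fin N) (Fin N) ℂ) * M).trace.re; μ] =
        ∫ g : SUN N, ((g : Matrix (Fin N) (Fin N) ℂ) * M).trace.re ^ 2 ∂(haarSU N) := fun M => (key M).2
  refine ⟨?_, ?_⟩
  · rw [Finset.sum_congr rfl fun a _ => Finset.sum_congr rfl fun b _ => Finset.sum_congr rfl fun c _ => k1 (Matrix.single b a c)]
    simp_rw [Finset.sum_insert hne, Finset.sum_singleton, ← mul_add, ← Finset.mul_sum]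
    rw [sum_integral_sq_entries_sun hN0]
  · rw [Finset.sum_congr rfl fun a _ => Finset.sum_congr rfl fun b _ => Finset.sum_congr rfl fun c _ => k2 (Matrix.single b a c)]
    simp_rw [Finset.sum_insert hne, Finset.sum_singleton]
    exact sum_integral_sq_entries_sun hN0

/-- ★★★ **THE HAAR CEILING (Elitzur): the spectral gap of the `SU(N)` lattice Langevin generator never exceeds the free one-link value `N − 1/N`,
at ANY coupling and ANY volume.**  If a constant `c` satisfies the Poincaré inequality `c·Var_{μ_{Λ_L,β'}}(u) ≤ ∫ Γ(u,u) dμ_{Λ_L,β'}` for every smooth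
function `u` of the link matrices on the torus `(ℤ/L)^d` (`L ≥ 2`, `N ≥ 2`, any `β'`), then `c ≤ N − 1/N = (N² − 1)/N`: tested on the `2N²` entry
observables of one link, whose law is Haar by gauge invariance.  HONEST FRAMING: an upper bound in LATTICE units at fixed cut-off; no bearing on
`K`-uniformity in physical units; the Yang–Mills mass gap is NOT proved. [cite: Elitzur1975, (local gauge invariance)] -/
theorem poincareConst_le_haarCeiling_sun (hN : 2 ≤ N) (hL : 1 < L) (β' : ℝ) (e₀ : Edge d L) {c : ℝ}
    (hc : ∀ u : Cfg (Edge d L) N → ℝ, ContDiff ℝ ∞ u →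
      c * Var[fun U : GaugeConfig d L (SUN N) => u (emb U); wilsonMeasure (d := d) (L := L) (fundamentalRep (Fin N)) β'] ≤
        ∫ U, Gam u u (emb U) ∂(wilsonMeasure (d := d) (L := L) (fundamentalRep (Fin N)) β')) :
    c ≤ (N : ℝ) - 1 / N := by
  obtain ⟨hG, hV⟩ := rayleigh_linkEntries_sun (d := d) (L := L) hN hL β' e₀
  have hNpos : (0 : ℝ) < N := by exact_mod_cast (show 0 < N by omega)
  have hsum : (∑ a : Fin N, ∑ b : Fin N, ∑ z ∈ ({(1 : ℂ), -Complex.I} : Finset ℂ),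
      c * Var[fun U : GaugeConfig d L (SUN N) => ((U e₀ : Matrix (Fin N) (Fin N) ℂ) * Matrix.single b a z).trace.re;
        wilsonMeasure (d := d) (L := L) (fundamentalRep (Fin N)) β']) ≤
      ∑ a : Fin N, ∑ b : Fin N, ∑ z ∈ ({(1 : ℂ), -Complex.I} : Finset ℂ),
        ∫ U, Gam (fun Q : Cfg (Edge d L) N => (Q e₀ * Matrix.single b a z).trace.re) (fun Q => (Q e₀ * Matrix.single b a z).trace.re) (emb U)
          ∂(wilsonMeasure (d := d) (L := L) (fundamentalRep (Fin N)) β') :=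
    Finset.sum_le_sum fun a _ => Finset.sum_le_sum fun b _ => Finset.sum_le_sum fun z _ =>
      hc (fun Q : Cfg (Edge d L) N => (Q e₀ * Matrix.single b a z).trace.re)
        ((contDiff_reTrMul (Matrix.single b a z)).comp (contDiff_apply ℝ (Matrix (Fin N) (Fin N) ℂ) e₀))
  have hl : (∑ a : Fin N, ∑ b : Fin N, ∑ z ∈ ({(1 : ℂ), -Complex.I} : Finset ℂ),
      c * Var[fun U : GaugeConfig d L (SUN N) => ((U e₀ : Matrix (Fin N) (Fin N) ℂ) * Matrix.single b a z).trace.re;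
        wilsonMeasure (d := d) (L := L) (fundamentalRep (Fin N)) β']) =
      c * ∑ a : Fin N, ∑ b : Fin N, ∑ z ∈ ({(1 : ℂ), -Complex.I} : Finset ℂ),
        Var[fun U : GaugeConfig d L (SUN N) => ((U e₀ : Matrix (Fin N) (Fin N) ℂ) * Matrix.single b a z).trace.re;
          wilsonMeasure (d := d) (L := L) (fundamentalRep (Fin N)) β'] := by
    simp only [Finset.mul_sum]
  rw [hl, hV, hG] at hsum
  exact le_of_mul_le_mul_right hsum hNpos

/-- ★★ **The window for the optimal Poincaré constant at strong coupling**: for `|β| < 1/(8d)` the venture's Bakry–Émery constant and the Haar ceiling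
sandwich every admissible `c`: the constant `K = N/2 − 4dN|β|` IS admissible (G31 `torus_variance_le_integral_Gam_sun`) and every admissible `c` is
`≤ N − 1/N` — so the true fixed-lattice gap lies in `[N/2 − 4dN|β|, N − 1/N]`, a factor `< 2(1 − 1/N²)/(1 − 8d|β|)` window.  The Yang–Mills mass gap is
NOT proved. [cite: ShenZhuZhu2022, Remark 4.6] -/
theorem poincareConst_window_sun (hN : 2 ≤ N) (hL : 1 < L) {β : ℝ} (hK : 0 < (N : ℝ) / 2 - N * |β| * (4 * d)) (e₀ : Edge d L) :
    (∀ u : Cfg (Edge d L) N → ℝ, ContDiff ℝ ∞ u →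
      ((N : ℝ) / 2 - N * |β| * (4 * d)) * Var[fun U : GaugeConfig d L (SUN N) => u (emb U);
          wilsonMeasure (d := d) (L := L) (fundamentalRep (Fin N)) ((N : ℝ) * β)] ≤
        ∫ U, Gam u u (emb U) ∂(wilsonMeasure (d := d) (L := L) (fundamentalRep (Fin N)) ((N : ℝ) * β))) ∧
    (∀ c : ℝ, (∀ u : Cfg (Edge d L) N → ℝ, ContDiff ℝ ∞ u →
      c * Var[fun U : GaugeConfig d L (SUN N) => u (emb U); wilsonMeasure (d := d) (L := L) (fundamentalRep (Fin N)) ((N : ℝ) * β)] ≤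
        ∫ U, Gam u u (emb U) ∂(wilsonMeasure (d := d) (L := L) (fundamentalRep (Fin N)) ((N : ℝ) * β))) → c ≤ (N : ℝ) - 1 / N) ∧
    (N : ℝ) / 2 - N * |β| * (4 * d) ≤ (N : ℝ) - 1 / N := by
  have hN0 : N ≠ 0 := by omega
  have hlow : ∀ u : Cfg (Edge d L) N → ℝ, ContDiff ℝ ∞ u →
      ((N : ℝ) / 2 - N * |β| * (4 * d)) * Var[fun U : GaugeConfig d L (SUN N) => u (emb U);
          wilsonMeasure (d := d) (L := L) (fundamentalRep (Fin N)) ((N : ℝ) * β)] ≤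
        ∫ U, Gam u u (emb U) ∂(wilsonMeasure (d := d) (L := L) (fundamentalRep (Fin N)) ((N : ℝ) * β)) := by
    intro u hu
    have h := torus_variance_le_integral_Gam_sun (L := L) (Summit.Ventures.YMGap.HessianSharp.wilsonHessianBound_four_d d N) hN0 β hK hu
    rwa [le_div_iff₀ hK, mul_comm] at h
  exact ⟨hlow, fun c hc => poincareConst_le_haarCeiling_sun hN hL _ e₀ hc, poincareConst_le_haarCeiling_sun hN hL _ e₀ hlow⟩

end Ceiling

end Summit.QuantumFields.YangMills.Theorems.ColdStartUniversality

end
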